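import Mathlib
import Literature.Topology.FourManifolds.PlanarShadowWalk
import Literature.Topology.FourManifolds.PlanarShadowJunctions
import HarnessLib

/-!
# Peak reduction for the `F₂` shadow walk: every four-letter state of core letters with trivial
product reaches an honest double

Topic `Literature/Topology/FourManifolds`, sequel of `PlanarShadowJunctions.lean` (the four cases
at a junction of core letters) over the vocabulary of `PlanarShadowWalk.lean`
(`Literature.Topology.FourManifolds.PlanarShadow`: `Move`, `Reachable`, `IsPos`, `XYPairs`,
`startState`, `IsDoubleState`).  Pure combinatorial group theory, fully proved, no definitions;
it CLOSES, in the double form, the lever `stub_shadowWalkK4` of the line `Sketch` of crux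
`ConvexBisection.PlanarAcyclicBisectionRigidity` (stmt-SmoothPoincare4-15086): the `k = 4`
seam-walk conjecture K4-WALK — every pair of minimal positive factorisations of a planar
homotopy-sphere monodromy with four binding components is carried by signed Hurwitz moves to an
honest double (so, through the dictionary, the bisected 4-manifold is the double of a contractible
planar Stein domain).

Proof.  For a state `[ℓ₀, ℓ₁, ℓ₂, ℓ₃]` of core letters with `ℓ₀ℓ₁ℓ₂ℓ₃ = 1` let
`N = Σ ‖ℓᵢ‖`.  By `junction_cases` each junction is tame (J1), or a Hurwitz move / inverse move
there lowers `N` by `2` (J2/J3), or it is a cancelling pair `ℓᵢ₊₁ = ℓᵢ⁻¹` (J4); three tame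
junctions contradict `∏ = 1` (`prod_ne_one_of_J1`).  Hence by strong induction on `N`
(`reach_cancelPair`, §4; Hurwitz moves preserve the product and conjugate letters, so core
letters stay core letters) the state reaches one with an adjacent cancelling pair, which with
`∏ = 1` reads `[e, e⁻¹, f, f⁻¹]` or `[f, e, e⁻¹, f⁻¹]`.  A core letter or its inverse is positive
(`isPos_or_isPos_inv`), and eight explicit move sequences of length `≤ 4`, identities valid in
every group (`cfg_adjPP` … `cfg_nestMM`, §5), turn each sign pattern into an HONEST DOUBLE
`[g₁, g₂, g₂⁻¹, g₁⁻¹]` with `g₁, g₂` positive (`reach_double_adj`, `reach_double_nest`).  Main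
statements: `reach_double` (§6) and `reach_double_startState` — for any `w ∈ F₂` and
`P, Q ∈ XYPairs w` the start state `[P.1, P.2, Q.2⁻¹, Q.1⁻¹]` reaches an `IsDoubleState`.
Method: E. Artin, *Theory of braids*, Ann. of Math. 48 (1947), §§7–9 (peak reduction);
Lyndon–Schupp, *Combinatorial Group Theory*, Ch. I §2.

Deliberately not here: the ball target `IsBallState` (it needs `⟨P.1, P.2, Q.1⟩ = F₂`, an
invariant of the walk, and is not always reachable); anything about the planar dictionary.
-/

namespace Literature.Topology.FourManifolds.PlanarShadow

open FreeGroup Literature.GroupTheory.CombinatorialGroupTheory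

/-! ## §4 Hurwitz moves on four-letter states; the descent to a cancelling pair -/

/-- The Hurwitz move at position `0` as a reachability step. [folklore] -/
theorem reach_h0 {a b c d x : F₂} (hx : x = a * b * a⁻¹) : Reachable [a, b, c, d] [x, a, c, d] := by
  subst hx; exact Relation.ReflTransGen.single (Or.inl (Move.hurwitz [] [c, d] a b))

/-- The Hurwitz move at position `1` as a reachability step. [folklore] -/
theorem reach_h1 {a b c d x : F₂} (hx : x = b * c * b⁻¹) : Reachable [a, b, c, d] [a, x, b, d] := by
  subst hx; exact Relation.ReflTransGen.single (Or.inl (Move.hurwitz [a] [d] b c))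

/-- The Hurwitz move at position `2` as a reachability step. [folklore] -/
theorem reach_h2 {a b c d x : F₂} (hx : x = c * d * c⁻¹) : Reachable [a, b, c, d] [a, b, x, c] := by
  subst hx; exact Relation.ReflTransGen.single (Or.inl (Move.hurwitz [a, b] [] c d))

/-- The inverse Hurwitz move at position `0` as a reachability step. [folklore] -/
theorem reach_i0 {a b c d x : F₂} (hx : x = b⁻¹ * a * b) : Reachable [a, b, c, d] [b, x, c, d] := by
  subst hx; exact Relation.ReflTransGen.single (Or.inl (Move.hurwitzInv [] [c, d] a b))

/-- The inverse Hurwitz move at position `1` as a reachability step. [folklore] -/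
theorem reach_i1 {a b c d x : F₂} (hx : x = c⁻¹ * b * c) : Reachable [a, b, c, d] [a, c, x, d] := by
  subst hx; exact Relation.ReflTransGen.single (Or.inl (Move.hurwitzInv [a] [d] b c))

/-- The inverse Hurwitz move at position `2` as a reachability step. [folklore] -/
theorem reach_i2 {a b c d x : F₂} (hx : x = d⁻¹ * c * d) : Reachable [a, b, c, d] [a, b, d, x] := by
  subst hx; exact Relation.ReflTransGen.single (Or.inl (Move.hurwitzInv [a, b] [] c d))

/-- A conjugate of a core letter is a core letter with the same core. [folklore] -/
theorem isConj_conj {g : Fin 2 × Bool} {ℓ : F₂} (h : IsConj (FreeGroup.mk [g]) ℓ) (c : F₂) :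
    IsConj (FreeGroup.mk [g]) (c * ℓ * c⁻¹) :=
  h.trans (isConj_iff.2 ⟨c, rfl⟩)

/-- **Descent to a cancelling pair** (peak reduction, E. Artin 1947): four core letters with trivial
product are carried by Hurwitz moves — each lowering `Σ‖ℓᵢ‖` — to four core letters with trivial
product two adjacent of which are mutually inverse. [folklore] -/
theorem reach_cancelPair : ∀ (N : ℕ) (ℓ₀ ℓ₁ ℓ₂ ℓ₃ : F₂),
    ℓ₀.norm + ℓ₁.norm + ℓ₂.norm + ℓ₃.norm = N → ℓ₀ * ℓ₁ * ℓ₂ * ℓ₃ = 1 →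
    (∀ ℓ ∈ [ℓ₀, ℓ₁, ℓ₂, ℓ₃], ∃ g : Fin 2 × Bool, IsConj (FreeGroup.mk [g]) ℓ) →
    ∃ m₀ m₁ m₂ m₃ : F₂, Reachable [ℓ₀, ℓ₁, ℓ₂, ℓ₃] [m₀, m₁, m₂, m₃] ∧ m₀ * m₁ * m₂ * m₃ = 1 ∧
      (∀ ℓ ∈ [m₀, m₁, m₂, m₃], ∃ g : Fin 2 × Bool, IsConj (FreeGroup.mk [g]) ℓ) ∧
      (m₁ = m₀⁻¹ ∨ m₂ = m₁⁻¹ ∨ m₃ = m₂⁻¹) := by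
  intro N
  induction N using Nat.strong_induction_on with
  | _ N ih =>
    intro ℓ₀ ℓ₁ ℓ₂ ℓ₃ hN hprod hcore
    have hc₀ := hcore ℓ₀ (by simp)
    have hc₁ := hcore ℓ₁ (by simp)
    have hc₂ := hcore ℓ₂ (by simp)
    have hc₃ := hcore ℓ₃ (by simp)
    obtain ⟨g₀, hg₀⟩ := hc₀
    obtain ⟨g₁, hg₁⟩ := hc₁
    obtain ⟨g₂, hg₂⟩ := hc₂
    obtain ⟨g₃, hg₃⟩ := hc₃
    obtain ⟨A₀, hA₀⟩ := exists_toWord_eq_of_isConj hg₀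
    obtain ⟨A₁, hA₁⟩ := exists_toWord_eq_of_isConj hg₁
    obtain ⟨A₂, hA₂⟩ := exists_toWord_eq_of_isConj hg₂
    obtain ⟨A₃, hA₃⟩ := exists_toWord_eq_of_isConj hg₃
    -- a state already carrying a cancelling pair is its own witness
    have done : (ℓ₁ = ℓ₀⁻¹ ∨ ℓ₂ = ℓ₁⁻¹ ∨ ℓ₃ = ℓ₂⁻¹) →
        ∃ m₀ m₁ m₂ m₃ : F₂, Reachable [ℓ₀, ℓ₁, ℓ₂, ℓ₃] [m₀, m₁, m₂, m₃] ∧ m₀ * m₁ * m₂ * m₃ = 1 ∧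
          (∀ ℓ ∈ [m₀, m₁, m₂, m₃], ∃ g : Fin 2 × Bool, IsConj (FreeGroup.mk [g]) ℓ) ∧
          (m₁ = m₀⁻¹ ∨ m₂ = m₁⁻¹ ∨ m₃ = m₂⁻¹) :=
      fun h => ⟨ℓ₀, ℓ₁, ℓ₂, ℓ₃, Reachable.refl _, hprod, hcore, h⟩
    -- a length-reducing move followed by the induction hypothesis
    have step : ∀ (m₀ m₁ m₂ m₃ : F₂), Reachable [ℓ₀, ℓ₁, ℓ₂, ℓ₃] [m₀, m₁, m₂, m₃] →
        m₀.norm + m₁.norm + m₂.norm + m₃.norm < N → m₀ * m₁ * m₂ * m₃ = 1 →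
        (∀ ℓ ∈ [m₀, m₁, m₂, m₃], ∃ g : Fin 2 × Bool, IsConj (FreeGroup.mk [g]) ℓ) →
        ∃ m₀ m₁ m₂ m₃ : F₂, Reachable [ℓ₀, ℓ₁, ℓ₂, ℓ₃] [m₀, m₁, m₂, m₃] ∧ m₀ * m₁ * m₂ * m₃ = 1 ∧
          (∀ ℓ ∈ [m₀, m₁, m₂, m₃], ∃ g : Fin 2 × Bool, IsConj (FreeGroup.mk [g]) ℓ) ∧
          (m₁ = m₀⁻¹ ∨ m₂ = m₁⁻¹ ∨ m₃ = m₂⁻¹) := by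
      intro m₀ m₁ m₂ m₃ hr hlt hp hc
      obtain ⟨n₀, n₁, n₂, n₃, hr', hp', hc', hpair⟩ := ih _ hlt m₀ m₁ m₂ m₃ rfl hp hc
      exact ⟨n₀, n₁, n₂, n₃, hr.trans hr', hp', hc', hpair⟩
    have cores : ∀ (x y z t : F₂) (gx' gy' gz gt : Fin 2 × Bool),
        IsConj (FreeGroup.mk [gx']) x → IsConj (FreeGroup.mk [gy']) y → IsConj (FreeGroup.mk [gz]) z →
        IsConj (FreeGroup.mk [gt]) t →
        ∀ ℓ ∈ [x, y, z, t], ∃ g : Fin 2 × Bool, IsConj (FreeGroup.mk [g]) ℓ := by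
      intro x y z t gx' gy' gz gt hx hy hz ht ℓ hℓ
      simp only [List.mem_cons, List.not_mem_nil, or_false] at hℓ
      rcases hℓ with rfl | rfl | rfl | rfl
      exacts [⟨_, hx⟩, ⟨_, hy⟩, ⟨_, hz⟩, ⟨_, ht⟩]
    -- junction 0
    rcases junction_cases hA₀ hA₁ with ⟨k₀A, k₀B⟩ | J2 | J3 | J4
    rotate_left
    · exact step _ _ _ _ (reach_h0 rfl) (by omega) (by rw [← hprod]; group)
        (cores _ _ _ _ _ _ _ _ (isConj_conj hg₁ ℓ₀) hg₀ hg₂ hg₃)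
    · exact step _ _ _ _ (reach_i0 rfl) (by omega) (by rw [← hprod]; group)
        (cores _ _ _ _ _ g₀ _ _ hg₁ (by simpa using isConj_conj hg₀ ℓ₁⁻¹) hg₂ hg₃)
    · exact done (Or.inl J4)
    -- junction 1
    rcases junction_cases hA₁ hA₂ with ⟨k₁A, k₁B⟩ | J2 | J3 | J4
    rotate_left
    · exact step _ _ _ _ (reach_h1 rfl) (by omega) (by rw [← hprod]; group)
        (cores _ _ _ _ _ _ _ _ hg₀ (isConj_conj hg₂ ℓ₁) hg₁ hg₃)
    · exact step _ _ _ _ (reach_i1 rfl) (by omega) (by rw [← hprod]; group)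
        (cores _ _ _ _ _ _ g₁ _ hg₀ hg₂ (by simpa using isConj_conj hg₁ ℓ₂⁻¹) hg₃)
    · exact done (Or.inr (Or.inl J4))
    -- junction 2
    rcases junction_cases hA₂ hA₃ with ⟨k₂A, k₂B⟩ | J2 | J3 | J4
    rotate_left
    · exact step _ _ _ _ (reach_h2 rfl) (by omega) (by rw [← hprod]; group)
        (cores _ _ _ _ _ _ _ _ hg₀ hg₁ (isConj_conj hg₃ ℓ₂) hg₂)
    · exact step _ _ _ _ (reach_i2 rfl) (by omega) (by rw [← hprod]; group)
        (cores _ _ _ _ _ _ _ g₂ hg₀ hg₁ hg₃ (by simpa using isConj_conj hg₂ ℓ₃⁻¹))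
    · exact done (Or.inr (Or.inr J4))
    -- three tame junctions contradict `∏ = 1`
    exact absurd hprod (prod_ne_one_of_J1 hA₀ hA₁ hA₂ hA₃ k₀A k₀B k₁A k₁B k₂A k₂B)

/-! ## §5 From a cancelling pair to an honest double: eight short move sequences -/

/-- Positivity is a conjugacy invariant. [folklore] -/
theorem IsPos.conj {q : F₂} (h : IsPos q) (c : F₂) : IsPos (c * q * c⁻¹) := by
  obtain ⟨e, he | he⟩ := h
  · exact ⟨c * e, Or.inl (by rw [he]; group)⟩
  · exact ⟨c * e, Or.inr (by rw [he]; group)⟩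

/-- A core letter or its inverse is positive. [folklore] -/
theorem isPos_or_isPos_inv {g : Fin 2 × Bool} {ℓ : F₂} (h : IsConj (FreeGroup.mk [g]) ℓ) :
    IsPos ℓ ∨ IsPos ℓ⁻¹ := by
  obtain ⟨c, hc⟩ := isConj_iff.1 h
  have hx : (FreeGroup.mk [((0 : Fin 2), true)] : F₂) = gx := rfl
  have hy : (FreeGroup.mk [((1 : Fin 2), true)] : F₂) = gy := rfl
  have hx' : (FreeGroup.mk [((0 : Fin 2), false)] : F₂) = gx⁻¹ := by
    rw [← hx, ← mk_flip_eq_inv]; rfl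
  have hy' : (FreeGroup.mk [((1 : Fin 2), false)] : F₂) = gy⁻¹ := by
    rw [← hy, ← mk_flip_eq_inv]; rfl
  have hg : g = (0, true) ∨ g = (0, false) ∨ g = (1, true) ∨ g = (1, false) := by
    obtain ⟨i, b⟩ := g
    fin_cases i <;> cases b <;> simp
  rcases hg with rfl | rfl | rfl | rfl
  · left; exact ⟨c, Or.inl (by rw [← hc, hx])⟩
  · right; refine ⟨c, Or.inl ?_⟩; rw [← hc, hx']; group
  · left; exact ⟨c, Or.inr (by rw [← hc, hy])⟩
  · right; refine ⟨c, Or.inr ?_⟩; rw [← hc, hy']; group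

/-- `[p, p⁻¹, q, q⁻¹] ⟶ [q, p, p⁻¹, q⁻¹]` (moves `σ₁ σ₀`). [folklore] -/
theorem cfg_adjPP (p q : F₂) : Reachable [p, p⁻¹, q, q⁻¹] [q, p, p⁻¹, q⁻¹] := by
  have h1 : Reachable [p, p⁻¹, q, q⁻¹] [p, p⁻¹ * q * p, p⁻¹, q⁻¹] := reach_h1 (by group)
  have h2 : Reachable [p, p⁻¹ * q * p, p⁻¹, q⁻¹] [q, p, p⁻¹, q⁻¹] := reach_h0 (by group)
  exact h1.trans h2

/-- `[p, p⁻¹, q⁻¹, q] ⟶ [p, p⁻¹qp, p⁻¹q⁻¹p, p⁻¹]` (moves `σ₁ σ₂ σ₁`). [folklore] -/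
theorem cfg_adjPM (p q : F₂) :
    Reachable [p, p⁻¹, q⁻¹, q] [p, p⁻¹ * q * p, (p⁻¹ * q * p)⁻¹, p⁻¹] := by
  have h1 : Reachable [p, p⁻¹, q⁻¹, q] [p, p⁻¹ * q⁻¹ * p, p⁻¹, q] := reach_h1 (by group)
  have h2 : Reachable [p, p⁻¹ * q⁻¹ * p, p⁻¹, q] [p, p⁻¹ * q⁻¹ * p, p⁻¹ * q * p, p⁻¹] :=
    reach_h2 (by group)
  have h3 : Reachable [p, p⁻¹ * q⁻¹ * p, p⁻¹ * q * p, p⁻¹] [p, p⁻¹ * q * p, (p⁻¹ * q * p)⁻¹, p⁻¹] := by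
    have e : (p⁻¹ * q * p)⁻¹ = p⁻¹ * q⁻¹ * p := by group
    rw [e]; exact reach_h1 (by group)
  exact (h1.trans h2).trans h3

/-- `[p⁻¹, p, q, q⁻¹] ⟶ [q, p, p⁻¹, q⁻¹]` (moves `σ₀ σ₁ σ₀`). [folklore] -/
theorem cfg_adjMP (p q : F₂) : Reachable [p⁻¹, p, q, q⁻¹] [q, p, p⁻¹, q⁻¹] := by
  have h1 : Reachable [p⁻¹, p, q, q⁻¹] [p, p⁻¹, q, q⁻¹] := reach_h0 (by group)
  exact h1.trans (cfg_adjPP p q)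

/-- `[p⁻¹, p, q⁻¹, q] ⟶ [p, p⁻¹qp, p⁻¹q⁻¹p, p⁻¹]` (moves `σ₀ σ₁ σ₂ σ₁`). [folklore] -/
theorem cfg_adjMM (p q : F₂) :
    Reachable [p⁻¹, p, q⁻¹, q] [p, p⁻¹ * q * p, (p⁻¹ * q * p)⁻¹, p⁻¹] := by
  have h1 : Reachable [p⁻¹, p, q⁻¹, q] [p, p⁻¹, q⁻¹, q] := reach_h0 (by group)
  exact h1.trans (cfg_adjPM p q)

/-- `[p, q⁻¹, q, p⁻¹] ⟶ [p, q, q⁻¹, p⁻¹]` (move `σ₁`). [folklore] -/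
theorem cfg_nestPM (p q : F₂) : Reachable [p, q⁻¹, q, p⁻¹] [p, q, q⁻¹, p⁻¹] :=
  reach_h1 (by group)

/-- `[p⁻¹, q, q⁻¹, p] ⟶ [p⁻¹qp, p, p⁻¹, p⁻¹q⁻¹p]` (moves `σ₀ σ₂⁻¹ σ₁`). [folklore] -/
theorem cfg_nestMP (p q : F₂) :
    Reachable [p⁻¹, q, q⁻¹, p] [p⁻¹ * q * p, p, p⁻¹, (p⁻¹ * q * p)⁻¹] := by
  have h1 : Reachable [p⁻¹, q, q⁻¹, p] [p⁻¹ * q * p, p⁻¹, q⁻¹, p] := reach_h0 (by group)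
  have h2 : Reachable [p⁻¹ * q * p, p⁻¹, q⁻¹, p] [p⁻¹ * q * p, p⁻¹, p, p⁻¹ * q⁻¹ * p] :=
    reach_i2 (by group)
  have h3 : Reachable [p⁻¹ * q * p, p⁻¹, p, p⁻¹ * q⁻¹ * p] [p⁻¹ * q * p, p, p⁻¹, (p⁻¹ * q * p)⁻¹] := by
    have e : (p⁻¹ * q * p)⁻¹ = p⁻¹ * q⁻¹ * p := by group
    rw [e]; exact reach_h1 (by group)
  exact (h1.trans h2).trans h3

/-- `[p⁻¹, q⁻¹, q, p] ⟶ [p⁻¹qp, p, p⁻¹, p⁻¹q⁻¹p]` (moves `σ₁ σ₀ σ₂⁻¹ σ₁`). [folklore] -/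
theorem cfg_nestMM (p q : F₂) :
    Reachable [p⁻¹, q⁻¹, q, p] [p⁻¹ * q * p, p, p⁻¹, (p⁻¹ * q * p)⁻¹] := by
  have h1 : Reachable [p⁻¹, q⁻¹, q, p] [p⁻¹, q, q⁻¹, p] := reach_h1 (by group)
  exact h1.trans (cfg_nestMP p q)

/-- **An adjacent-pairs state `[e, e⁻¹, f, f⁻¹]` of core letters reaches an honest double.**
[folklore] -/
theorem reach_double_adj {ge gf : Fin 2 × Bool} {e f : F₂} (he : IsConj (FreeGroup.mk [ge]) e)
    (hf : IsConj (FreeGroup.mk [gf]) f) : ∃ t, Reachable [e, e⁻¹, f, f⁻¹] t ∧ IsDoubleState t := by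
  rcases isPos_or_isPos_inv he with hp | hp <;> rcases isPos_or_isPos_inv hf with hq | hq
  · exact ⟨_, cfg_adjPP e f, f, e, hq, hp, rfl⟩
  · have key := cfg_adjPM e f⁻¹
    simp only [inv_inv] at key
    exact ⟨_, key, e, e⁻¹ * f⁻¹ * e, hp, by simpa using hq.conj e⁻¹, rfl⟩
  · have key := cfg_adjMP e⁻¹ f
    simp only [inv_inv] at key
    exact ⟨_, key, f, e⁻¹, hq, hp, by simp⟩
  · have key := cfg_adjMM e⁻¹ f⁻¹
    simp only [inv_inv] at key
    exact ⟨_, key, e⁻¹, e * f⁻¹ * e⁻¹, hp, hq.conj e, by simp⟩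

/-- **A nested state `[f, e, e⁻¹, f⁻¹]` of core letters reaches an honest double.** [folklore] -/
theorem reach_double_nest {ge gf : Fin 2 × Bool} {e f : F₂} (he : IsConj (FreeGroup.mk [ge]) e)
    (hf : IsConj (FreeGroup.mk [gf]) f) : ∃ t, Reachable [f, e, e⁻¹, f⁻¹] t ∧ IsDoubleState t := by
  rcases isPos_or_isPos_inv hf with hp | hp <;> rcases isPos_or_isPos_inv he with hq | hq
  · exact ⟨_, Reachable.refl _, f, e, hp, hq, rfl⟩
  · have key := cfg_nestPM f e⁻¹
    simp only [inv_inv] at key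
    exact ⟨_, key, f, e⁻¹, hp, hq, by simp⟩
  · have key := cfg_nestMP f⁻¹ e
    simp only [inv_inv] at key
    exact ⟨_, key, f * e * f⁻¹, f⁻¹, hq.conj f, hp, by simp⟩
  · have key := cfg_nestMM f⁻¹ e⁻¹
    simp only [inv_inv] at key
    exact ⟨_, key, f * e⁻¹ * f⁻¹, f⁻¹, hq.conj f, hp, by simp⟩

/-! ## §6 Assembly -/

/-- **Every four-letter state of core letters with trivial product reaches an honest double.**
[folklore] -/
theorem reach_double (ℓ₀ ℓ₁ ℓ₂ ℓ₃ : F₂) (hprod : ℓ₀ * ℓ₁ * ℓ₂ * ℓ₃ = 1)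
    (hcore : ∀ ℓ ∈ [ℓ₀, ℓ₁, ℓ₂, ℓ₃], ∃ g : Fin 2 × Bool, IsConj (FreeGroup.mk [g]) ℓ) :
    ∃ t, Reachable [ℓ₀, ℓ₁, ℓ₂, ℓ₃] t ∧ IsDoubleState t := by
  obtain ⟨m₀, m₁, m₂, m₃, hr, hp, hc, hpair⟩ := reach_cancelPair _ ℓ₀ ℓ₁ ℓ₂ ℓ₃ rfl hprod hcore
  obtain ⟨g₀, hg₀⟩ := hc m₀ (by simp)
  obtain ⟨g₁, hg₁⟩ := hc m₁ (by simp)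
  obtain ⟨g₂, hg₂⟩ := hc m₂ (by simp)
  rcases hpair with h01 | h12 | h23
  · -- `[m₀, m₀⁻¹, m₂, m₂⁻¹]`
    have h3 : m₃ = m₂⁻¹ := by
      rw [h01] at hp
      have : m₂ * m₃ = 1 := by rw [← hp]; group
      exact (eq_inv_of_mul_eq_one_right this)
    subst h01; subst h3
    obtain ⟨t, ht, hd⟩ := reach_double_adj hg₀ hg₂
    exact ⟨t, hr.trans ht, hd⟩
  · -- `[m₀, m₁, m₁⁻¹, m₀⁻¹]`
    have h3 : m₃ = m₀⁻¹ := by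
      rw [h12] at hp
      have : m₀ * m₃ = 1 := by rw [← hp]; group
      exact (eq_inv_of_mul_eq_one_right this)
    subst h12; subst h3
    obtain ⟨t, ht, hd⟩ := reach_double_nest hg₁ hg₀
    exact ⟨t, hr.trans ht, hd⟩
  · -- `[m₀, m₀⁻¹, m₂, m₂⁻¹]` again
    have h1 : m₁ = m₀⁻¹ := by
      rw [h23] at hp
      have : m₀ * m₁ = 1 := by rw [← hp]; group
      exact (eq_inv_of_mul_eq_one_right this)
    subst h23; subst h1
    obtain ⟨t, ht, hd⟩ := reach_double_adj hg₀ hg₂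
    exact ⟨t, hr.trans ht, hd⟩

/-- **The lever's start states reach an honest double**: for any two ordered pairs
`P = (a₁, a₂)`, `Q = (b₁, b₂)` of (conjugate of `x`, conjugate of `y`) with the same product `w`,
the shadow block word `[a₁, a₂, b₂⁻¹, b₁⁻¹]` is carried by signed Hurwitz moves to an honest
double `[g₁, g₂, g₂⁻¹, g₁⁻¹]`. [folklore] -/
theorem reach_double_startState (w : F₂) (P Q : F₂ × F₂) (hP : P ∈ XYPairs w) (hQ : Q ∈ XYPairs w) :
    ∃ t : List F₂, Reachable (startState P Q) t ∧ IsDoubleState t := by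
  obtain ⟨⟨c₁, hc₁⟩, ⟨c₂, hc₂⟩, hPw⟩ := hP
  obtain ⟨⟨d₁, hd₁⟩, ⟨d₂, hd₂⟩, hQw⟩ := hQ
  have hx : (FreeGroup.mk [((0 : Fin 2), true)] : F₂) = gx := rfl
  have hy : (FreeGroup.mk [((1 : Fin 2), true)] : F₂) = gy := rfl
  have hx' : (FreeGroup.mk [((0 : Fin 2), false)] : F₂) = gx⁻¹ := by
    rw [← hx, ← mk_flip_eq_inv]; rfl
  have hy' : (FreeGroup.mk [((1 : Fin 2), false)] : F₂) = gy⁻¹ := by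
    rw [← hy, ← mk_flip_eq_inv]; rfl
  apply reach_double
  · have : P.1 * P.2 * Q.2⁻¹ * Q.1⁻¹ = (P.1 * P.2) * (Q.1 * Q.2)⁻¹ := by group
    rw [this, hPw, hQw, mul_inv_cancel]
  · intro ℓ hℓ
    simp only [List.mem_cons, List.not_mem_nil, or_false] at hℓ
    rcases hℓ with rfl | rfl | rfl | rfl
    · exact ⟨(0, true), isConj_iff.2 ⟨c₁, by rw [hx, hc₁]⟩⟩
    · exact ⟨(1, true), isConj_iff.2 ⟨c₂, by rw [hy, hc₂]⟩⟩
    · exact ⟨(1, false), isConj_iff.2 ⟨d₂, by rw [hy', hd₂]; group⟩⟩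
    · exact ⟨(0, false), isConj_iff.2 ⟨d₁, by rw [hx', hd₁]; group⟩⟩

end Literature.Topology.FourManifolds.PlanarShadow
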